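import Summits.HodgeConjecture.HodgeConjecture.Theses.LinearSystemTorelli
import Literature.AlgebraicGeometry.HodgeTheory.ComplexGysinHodgeType
import Literature.AlgebraicGeometry.HodgeTheory.CupPreservesHodgeTypeOfDeRham
import Literature.AlgebraicGeometry.HodgeTheory.HodgeFiltrationModelsReductionProofs
import Literature.AlgebraicGeometry.HodgeTheory.ComplexConjugationHolds
import Literature.AlgebraicGeometry.HodgeTheory.HodgeTypeConjugation
import Literature.NumberTheory.Transcendental.DeRhamTheoremMultiplicative

/-!
# Crux `TranscendentalOrSupported` (stmt-HodgeConjecture-10853), line `Sketch` — stub `stub_perpSubHodge`: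
# the Hodge theory of the cup-orthogonal of a rational sub-Hodge structure

Helper file for the line skeleton of the crux `TranscendentalOrSupported` of route
`LinearSystemTorelli` (GHC(2p, coniveau 1) in Grothendieck's sub-Hodge form), registered stub
`stub_perpSubHodge`. Notation: `X` smooth projective of dimension `2p` over `ℂ`, `A` a Hodge model
of `X` (`A.pullback k : Hᵏ(X(ℂ); ℂ) → Hᵏ(X^an; ℂ)` the bijective comparison, `A.hodgePQ k a c` the
piece `H^{a,c}` of the model), `b : Fin r → H²ᵖ(X(ℂ); ℂ)` RATIONAL classes with span
`V := span ℂ (range b)` and pulled-back span `W := V.map (A.pullback 2p) ⊆ H²ᵖ(X^an; ℂ)`, `μ` an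
orientation family, `B(a, c) := ⟨a ⌣ c, [X(ℂ)]_μ⟩ = cupPairing (μ hX) _ a c` the cup product
pairing on `H²ᵖ(X(ℂ); ℂ)`, and `V⊥ := ⨅ⱼ ker B(b j, –)` the right-orthogonal of `V`.

CLAIM (`stub_perpSubHodge`). If `W = ⨆_{p'+q'=2p} W ⊓ H^{p',q'}` (a sub-Hodge structure of the
model) and `W ⊓ H^{2p,0} = ⊥`, then (i) `V⊥` pulled back to `A` is again a sub-Hodge structure,
`V⊥.map A^* = ⨆_{p'+q'=2p} V⊥.map A^* ⊓ H^{p',q'}`, and (ii) `V⊥` contains every class `x` with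
`A^* x ∈ H^{2p,0}`.

PROOF (Voisin I, §7.3.2, the computation of Lemma 7.30, on the tree's carriers).
* Components stay in `V` (`perpSubHodge_component_mem`): for `c ∈ V` with Hodge decomposition
  `c = Σ_{a+d=2p} c^{a,d}` (`HodgeModel.exists_sum_eq_of_hodgeDecomposition`), every `c^{a,d} ∈ V` —
  `A^* c ∈ W = ⨆ W ⊓ H^{a,d}` gives a second decomposition with components in `W`, and the
  decomposition into types is unique (the pieces `H^{a,d}` are independent, field
  `HodgeModel.isInternal_hodgePQ` transported along the de Rham comparison;
  `perpSubHodge_hodgeComponents_unique`).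
* Type-orthogonality (`perpSubHodge_cupPairing_eq_zero_of_hodgeType`): `B(a, c) = 0` for `a` of
  type `(s, t)` and `c` of type `(s', t')` unless `(s + s', t + t') = (2p, 2p)` — the cup product adds
  Hodge types (`CupPreservesHodgeType`, the tree's theorem from de Rham's theorem in multiplicative
  form, `cupPreservesHodgeType_of_nonempty_hodgeModel` fed with the PROVED facts
  `hodgePQ_independent_of_hodgeModel_holds`, `nonempty_hodgeModel_holds`,
  `exists_deRhamIsoFamily_holds`) and a top-degree class of type `≠ (2p, 2p)` vanishes
  (`cupProduct_eq_zero_of_hodgeType`).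
* (i) (`perpSubHodge_isSubHodge`): for `x ∈ V⊥` with components `x^{a,d}`, each `x^{a,d} ∈ V⊥`:
  `B(b j, x^{a,d}) = Σ B(w^{s,t}, x^{a,d})` over the components `w^{s,t} ∈ V` of `b j`; the
  non-complementary terms vanish by types, and for the complementary type
  `B(w^{2p-a,2p-d}, x^{a,d}) = B(w^{2p-a,2p-d}, x) = 0` (the other components of `x` pair to zero
  with `w^{2p-a,2p-d}` by types; `w^{…} ∈ V` and `x ∈ V⊥`).
* (ii) (`perpSubHodge_containsTop`): for `A^* x ∈ H^{2p,0}`, `B(b j, x) = Σ B(w^{s,t}, x)`; only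
  `(s, t) = (0, 2p)` is complementary to `(2p, 0)`, and `A^* w^{0,2p} ∈ W ⊓ H^{0,2p} = ⊥`
  (`perpSubHodge_inf_hodgePQ_swap_eq_bot`: `W` is stable under complex conjugation — the `b j` are
  rational, hence real, `conjClass_mem_span_of_isRationalClass`, and conjugation commutes with
  `A^*`, `HodgeModel.pullback_conjClass` — and EVERY Hodge model of a smooth projective variety is
  Hodge symmetric, `HodgeModel.isHodgeSymmetric`: `conj H^{0,2p} ⊆ H^{2p,0}`; so
  `conj (W ⊓ H^{0,2p}) ⊆ W ⊓ H^{2p,0} = ⊥`).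

Pure tree theorems; no named fact is taken as a hypothesis and none is introduced.

References: C. Voisin, *Hodge Theory and Complex Algebraic Geometry I* (CUP 2002), §6.1.3
Cor. 6.12 and Cor. 6.14, Thm. 6.18, §7.1.1, §7.3.1, §7.3.2 with Lemma 7.30; A. Hatcher, *Algebraic
Topology* (CUP 2002), §3.3 Prop. 3.38; A. Grothendieck, *Hodge's general conjecture is false for
trivial reasons*, Topology 8 (1969), p. 300.
-/

-- `Summit.HodgeConjecture.HodgeConjecture.Theorems` is the mandated namespace (single-conjunct summit:
-- Sub = Summit), which `linter.dupNamespace` flags on every declaration; the lakefile turns the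
-- linter off tree-wide (weak option), restated here so stand-alone elaboration is warning-free too.
set_option linter.dupNamespace false

noncomputable section

namespace Summit.HodgeConjecture.HodgeConjecture.Theorems

open Literature.AlgebraicGeometry.HodgeTheory Literature.AlgebraicGeometry.Motives
open Literature.AlgebraicTopology.SingularHomology
-- `Finset.antidiagonal` alone resolves to the `Set.IsPWO` antidiagonal of `Data.Finset.MulAntidiagonal`
open Finset.HasAntidiagonal (antidiagonal mem_antidiagonal)

variable {n : ℕ} {X : SchemeOver ℂ}

/-! ### Lattice and Hodge-model lemmas -/

/-- Reindexing a supremum over `p + q = k` by the finite antidiagonal of `k`. [folklore] -/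
theorem perpSubHodge_iSup_eq_biSup_antidiagonal {β : Type*} [CompleteLattice β] (k : ℕ)
    (f : ℕ → ℕ → β) :
    ⨆ (p : ℕ) (q : ℕ) (_ : p + q = k), f p q = ⨆ i ∈ antidiagonal k, f i.1 i.2 := by
  rw [iSup_prod]
  simp only [mem_antidiagonal]

/-- **The decomposition into Hodge types is unique**: two families `v, w` of classes of
`Hᵏ(X^an; ℂ)` indexed by the antidiagonal of `k`, with `v (a, d), w (a, d) ∈ H^{a,d}` and the same
sum, agree termwise — the pieces `H^{a,d}`, `a + d = k`, of the Hodge decomposition of the model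
are independent (field `HodgeModel.isInternal_hodgePQ`, transported along the de Rham comparison
`A.deRham`; Voisin I Cor. 6.14: "a class of two different types is zero").
[cite: VoisinHodgeI2002, Thm. 6.18 and Cor. 6.14] -/
theorem perpSubHodge_hodgeComponents_unique (A : HodgeModel n X) (k : ℕ)
    {v w : ℕ × ℕ → singularCohomology ℂ ℂ A.carrier k}
    (hv : ∀ i ∈ antidiagonal k, v i ∈ A.hodgePQ k i.1 i.2)
    (hw : ∀ i ∈ antidiagonal k, w i ∈ A.hodgePQ k i.1 i.2)
    (h : ∑ i ∈ antidiagonal k, v i = ∑ i ∈ antidiagonal k, w i) :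
    ∀ i ∈ antidiagonal k, v i = w i := by
  have hind : iSupIndep fun pq : ↥(antidiagonal k) ↦ A.hodgePQ k pq.1.1 pq.1.2 :=
    (iSupIndep_map_orderIso_iff (Submodule.orderIsoMapComap (A.deRham A.carrier k))).2
      (A.isInternal_hodgePQ k).submodule_iSupIndep
  intro i hi
  exact (iSupIndep_iff_finsetSum_eq_imp_eq _).1 hind Finset.univ (fun j ↦ v j.1) (fun j ↦ w j.1)
    (fun j _ ↦ ⟨hv j.1 j.2, hw j.1 j.2⟩)
    (by rw [Finset.sum_coe_sort (antidiagonal k) v,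
      Finset.sum_coe_sort (antidiagonal k) w, h])
    ⟨i, hi⟩ (Finset.mem_univ _)

/-- **The Hodge components of a class of a sub-Hodge structure lie in it.** Let `A` be a Hodge
model of `X`, `V ⊆ Hᵏ(X(ℂ); ℂ)` a subspace whose pull-back `W := V.map A^*` is a sub-Hodge structure
(`W = ⨆_{p'+q'=k} W ⊓ H^{p',q'}`), `c ∈ V`, and `c = Σ_{a+d=k} z (a, d)` a decomposition with
`A^* z(a,d) ∈ H^{a,d}`. Then every `z (a, d) ∈ V`: `A^* c ∈ ⨆ W ⊓ H^{a,d}` is a sum of elements of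
the `W ⊓ H^{a,d}`, which by the uniqueness of the decomposition into types
(`perpSubHodge_hodgeComponents_unique`) are the `A^* z(a,d)`; and `A^*` is injective.
[cite: VoisinHodgeI2002, §7.3.1 (Lemma 7.25 and the remark after Lemma 7.26)] -/
theorem perpSubHodge_component_mem (A : HodgeModel n X) {k : ℕ} {V : Submodule ℂ (complexBetti X k)}
    (hV : V.map (A.pullback k).hom =
      ⨆ (p' : ℕ) (q' : ℕ) (_ : p' + q' = k), V.map (A.pullback k).hom ⊓ A.hodgePQ k p' q')
    {c : complexBetti X k} (hc : c ∈ V) {z : ℕ × ℕ → complexBetti X k}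
    (hz : ∑ i ∈ antidiagonal k, z i = c)
    (hzt : ∀ i ∈ antidiagonal k, A.pullback k (z i) ∈ A.hodgePQ k i.1 i.2) :
    ∀ i ∈ antidiagonal k, z i ∈ V := by
  -- the components of `A^* c` along the sub-Hodge decomposition of `W`
  have h1 : A.pullback k c ∈ ⨆ (p' : ℕ) (q' : ℕ) (_ : p' + q' = k),
      V.map (A.pullback k).hom ⊓ A.hodgePQ k p' q' := hV.le (Submodule.mem_map_of_mem hc)
  have hcW : A.pullback k c ∈ ⨆ i ∈ antidiagonal k,
      V.map (A.pullback k).hom ⊓ A.hodgePQ k i.1 i.2 :=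
    (perpSubHodge_iSup_eq_biSup_antidiagonal k
      fun p' q' ↦ V.map (A.pullback k).hom ⊓ A.hodgePQ k p' q').le h1
  obtain ⟨w, hw⟩ := (Submodule.mem_iSup_finset_iff_exists_sum _ _).1 hcW
  have hsum : ∑ i ∈ antidiagonal k, A.pullback k (z i) =
      ∑ i ∈ antidiagonal k, (w i : singularCohomology ℂ ℂ A.carrier k) := by
    rw [hw]
    change ∑ i ∈ antidiagonal k, (A.pullback k).hom (z i) = (A.pullback k).hom c
    rw [← map_sum, hz]
  intro i hi
  have heq : A.pullback k (z i) = w i :=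
    perpSubHodge_hodgeComponents_unique A k hzt (fun j _ ↦ (w j).2.2) hsum i hi
  -- `A^* (z i) = w i ∈ W`, and `A^*` is injective
  have hmem : A.pullback k (z i) ∈ V.map (A.pullback k).hom := heq ▸ (w i).2.1
  obtain ⟨y, hy, hyz⟩ := hmem
  obtain rfl : y = z i := A.pullback_injective k hyz
  exact hy

/-- **The pulled-back span of rational classes has no `(c, a)`-part if it has no `(a, c)`-part.**
For `X` smooth projective with Hodge model `A` and rational classes `b j ∈ Hᵏ(X(ℂ); ℂ)` with
pulled-back span `W`: `W ⊓ H^{a,c} = ⊥` implies `W ⊓ H^{c,a} = ⊥`. Indeed `W` is stable under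
complex conjugation (`conj (A^* c) = A^* (conj c)`, `HodgeModel.pullback_conjClass`, and the span of
the real classes `b j` is `conj`-stable, `conjClass_mem_span_of_isRationalClass`), every Hodge
model of `X` is Hodge symmetric (`HodgeModel.isHodgeSymmetric`: `conj H^{c,a} ⊆ H^{a,c}`, Voisin I
Cor. 6.12), so for `y ∈ W ⊓ H^{c,a}`, `conj y ∈ W ⊓ H^{a,c} = 0` and `y = conj (conj y) = 0`.
[cite: VoisinHodgeI2002, §6.1.3 Cor. 6.12] -/
theorem perpSubHodge_inf_hodgePQ_swap_eq_bot (hX : IsSmoothProjective n X) (A : HodgeModel n X)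
    {k r : ℕ} {b : Fin r → complexBetti X k} (hb : ∀ j, IsRationalClass (b j)) {a c : ℕ}
    (hac : (Submodule.span ℂ (Set.range b)).map (A.pullback k).hom ⊓ A.hodgePQ k a c = ⊥) :
    (Submodule.span ℂ (Set.range b)).map (A.pullback k).hom ⊓ A.hodgePQ k c a = ⊥ := by
  have hA : A.IsHodgeSymmetric := A.isHodgeSymmetric hX
  rw [eq_bot_iff]
  rintro y ⟨hyW, hy⟩
  have hconj : conjClass A.carrier k y ∈ (Submodule.span ℂ (Set.range b)).map (A.pullback k).hom := by
    obtain ⟨x, hx, rfl⟩ := hyW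
    exact ⟨conjClass _ k x, conjClass_mem_span_of_isRationalClass hb hx, A.pullback_conjClass k x⟩
  have h1 : conjClass A.carrier k y ∈
      (Submodule.span ℂ (Set.range b)).map (A.pullback k).hom ⊓ A.hodgePQ k a c :=
    ⟨hconj, hA k c a y hy⟩
  rw [hac, Submodule.mem_bot] at h1
  rw [Submodule.mem_bot, ← conjClass_conjClass y, h1, conjClass_zero]

/-! ### Type-orthogonality of the cup product pairing -/

/-- **The cup product preserves Hodge types on every smooth projective variety**, unconditionally:
the tree's `cupPreservesHodgeType_of_nonempty_hodgeModel` (from de Rham's theorem in multiplicative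
form) fed with the PROVED facts `hodgePQ_independent_of_hodgeModel_holds`,
`nonempty_hodgeModel_holds` and `exists_deRhamIsoFamily_holds`.
[cite: VoisinHodgeI2002, §5.3.2 Thm. 5.29 and §7.1.2] -/
theorem perpSubHodge_cupPreservesHodgeType (hX : IsSmoothProjective n X) : CupPreservesHodgeType n X :=
  cupPreservesHodgeType_of_nonempty_hodgeModel hodgePQ_independent_of_hodgeModel_holds
    nonempty_hodgeModel_holds
    (fun E _ _ _ ↦ Literature.NumberTheory.Transcendental.exists_deRhamIsoFamily_holds (E := E)) hX

/-- **Type-orthogonality of the cup product pairing** (Voisin I, Lemma 7.30, inclusion `⊆`): for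
`X` smooth projective of dimension `n` with Hodge model `A`, `k + l = 2n`, `a ∈ Hᵏ(X(ℂ); ℂ)` of type
`(p, q)` and `c ∈ Hˡ(X(ℂ); ℂ)` of type `(p', q')` with `(p + p', q + q') ≠ (n, n)`:
`⟨a ⌣ c, [X(ℂ)]_μ⟩ = 0`, since already `a ⌣ c = 0` (`cupProduct_eq_zero_of_hodgeType`, fed with
`perpSubHodge_cupPreservesHodgeType` and `hodgePQ_independent_of_hodgeModel_holds`).
[cite: VoisinHodgeI2002, Lemma 7.30 (proof)] -/
theorem perpSubHodge_cupPairing_eq_zero_of_hodgeType (μ : OrientationFamily)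
    (hX : IsSmoothProjective n X) (A : HodgeModel n X) {k l : ℕ} (h : k + l = 2 * n)
    {p q p' q' : ℕ} (hne : ¬ (p + p' = n ∧ q + q' = n)) {a : complexBetti X k}
    {c : complexBetti X l} (ha : A.pullback k a ∈ A.hodgePQ k p q)
    (hc : A.pullback l c ∈ A.hodgePQ l p' q') : cupPairing (μ hX) h a c = 0 := by
  rw [cupPairing_apply, cupProduct_eq_zero_of_hodgeType hodgePQ_independent_of_hodgeModel_holds hX A
    (perpSubHodge_cupPreservesHodgeType hX) h hne ha hc, map_zero, LinearMap.zero_apply]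

/-- A class right-orthogonal to the `b j` is right-orthogonal to their span (linearity of the
pairing in the first slot). [folklore] -/
theorem perpSubHodge_cupPairing_eq_zero_of_mem_span (μ : OrientationFamily)
    (hX : IsSmoothProjective n X) {k l : ℕ} (h : k + l = 2 * n) {r : ℕ}
    {b : Fin r → complexBetti X k} {x : complexBetti X l}
    (hx : x ∈ ⨅ j, LinearMap.ker (cupPairing (μ hX) h (b j))) {v : complexBetti X k}
    (hv : v ∈ Submodule.span ℂ (Set.range b)) : cupPairing (μ hX) h v x = 0 := by
  have hle : Submodule.span ℂ (Set.range b) ≤ LinearMap.ker ((cupPairing (μ hX) h).flip x) := by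
    rw [Submodule.span_le]
    rintro _ ⟨j, rfl⟩
    rw [SetLike.mem_coe, LinearMap.mem_ker, LinearMap.flip_apply]
    exact LinearMap.mem_ker.1 ((Submodule.mem_iInf _).1 hx j)
  have hvk := hle hv
  rwa [LinearMap.mem_ker, LinearMap.flip_apply] at hvk

/-! ### (i) The orthogonal of a sub-Hodge structure is a sub-Hodge structure -/

/-- **(i) `V⊥` is a sub-Hodge structure.** For `X` smooth projective of dimension `2p` with Hodge
model `A`, classes `b j ∈ H²ᵖ(X(ℂ); ℂ)` whose pulled-back span `W` satisfies
`W = ⨆_{p'+q'=2p} W ⊓ H^{p',q'}`, and an orientation family `μ`: the right-orthogonal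
`V⊥ = ⨅ⱼ ker ⟨b j ⌣ –, [X(ℂ)]⟩` pulled back to `A` is the supremum of its intersections with the
`H^{p',q'}`. Proof: the Hodge components `x^{a,d}` of `x ∈ V⊥`
(`HodgeModel.exists_sum_eq_of_hodgeDecomposition`) lie in `V⊥`: decomposing `b j = Σ w^{s,t}` with
`w^{s,t} ∈ span b` (`perpSubHodge_component_mem`), `⟨w^{s,t} ⌣ x^{a,d}⟩ = 0` by types unless
`(s, t) = (2p - a, 2p - d)` (`perpSubHodge_cupPairing_eq_zero_of_hodgeType`), and
`⟨w^{2p-a,2p-d} ⌣ x^{a,d}⟩ = ⟨w^{2p-a,2p-d} ⌣ x⟩ = 0` (the other components of `x` pair to zero with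
it by types; `x ∈ V⊥`, `perpSubHodge_cupPairing_eq_zero_of_mem_span`) — the computation of Voisin I,
Lemma 7.30. [cite: VoisinHodgeI2002, §7.3.1 and Lemma 7.30] -/
theorem perpSubHodge_isSubHodge (μ : OrientationFamily) {p : ℕ} (hX : IsSmoothProjective (2 * p) X)
    (A : HodgeModel (2 * p) X) {r : ℕ} (b : Fin r → complexBetti X (2 * p))
    (hsub : (Submodule.span ℂ (Set.range b)).map (A.pullback (2 * p)).hom =
      ⨆ (p' : ℕ) (q' : ℕ) (_ : p' + q' = 2 * p),
        (Submodule.span ℂ (Set.range b)).map (A.pullback (2 * p)).hom ⊓ A.hodgePQ (2 * p) p' q') :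
    (⨅ j, LinearMap.ker (cupPairing (μ hX) (two_mul (2 * p)).symm (b j))).map (A.pullback (2 * p)).hom =
        ⨆ (p' : ℕ) (q' : ℕ) (_ : p' + q' = 2 * p),
          (⨅ j, LinearMap.ker (cupPairing (μ hX) (two_mul (2 * p)).symm (b j))).map
            (A.pullback (2 * p)).hom ⊓ A.hodgePQ (2 * p) p' q' := by
  set P : Submodule ℂ (complexBetti X (2 * p)) :=
    ⨅ j, LinearMap.ker (cupPairing (μ hX) (two_mul (2 * p)).symm (b j)) with hP
  refine le_antisymm ?_ (iSup_le fun _ ↦ iSup_le fun _ ↦ iSup_le fun _ ↦ inf_le_left)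
  rintro _ ⟨x, hx, rfl⟩
  -- the Hodge components of `x`
  obtain ⟨z, hz, hzt⟩ := A.exists_sum_eq_of_hodgeDecomposition (2 * p) x
  -- each component is right-orthogonal to every `b j`
  have hzP : ∀ i ∈ antidiagonal (2 * p), z i ∈ P := by
    intro i hi
    rw [hP, Submodule.mem_iInf]
    intro j
    rw [LinearMap.mem_ker]
    -- the Hodge components of `b j` lie in `span b`
    obtain ⟨w, hw, hwt⟩ := A.exists_sum_eq_of_hodgeDecomposition (2 * p) (b j)
    have hwV : ∀ i' ∈ antidiagonal (2 * p), w i' ∈ Submodule.span ℂ (Set.range b) :=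
      perpSubHodge_component_mem A hsub (Submodule.subset_span ⟨j, rfl⟩) hw hwt
    rw [← hw, LinearMap.map_sum₂]
    refine Finset.sum_eq_zero fun i' hi' ↦ ?_
    by_cases hcomp : i'.1 + i.1 = 2 * p ∧ i'.2 + i.2 = 2 * p
    · -- the complementary type: `⟨w i' ⌣ z i⟩ = ⟨w i' ⌣ x⟩ = 0`
      obtain ⟨hc1, hc2⟩ := hcomp
      have key : cupPairing (μ hX) (two_mul (2 * p)).symm (w i') x =
          cupPairing (μ hX) (two_mul (2 * p)).symm (w i') (z i) := by
        rw [← hz, map_sum, Finset.sum_eq_single_of_mem i hi]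
        intro i'' hi'' hne''
        refine perpSubHodge_cupPairing_eq_zero_of_hodgeType μ hX A _ ?_ (hwt i' hi') (hzt i'' hi'')
        rintro ⟨h1, h2⟩
        exact hne'' (Prod.ext (by omega) (by omega))
      rw [← key]
      exact perpSubHodge_cupPairing_eq_zero_of_mem_span μ hX _ hx (hwV i' hi')
    · exact perpSubHodge_cupPairing_eq_zero_of_hodgeType μ hX A _ hcomp (hwt i' hi') (hzt i hi)
  -- hence `A^* x = Σ A^* (z i)` lies in `⨆ V⊥.map A^* ⊓ H^{a,d}`
  have hxsum : A.pullback (2 * p) x = ∑ i ∈ antidiagonal (2 * p), A.pullback (2 * p) (z i) := by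
    change (A.pullback (2 * p)).hom x = ∑ i ∈ antidiagonal (2 * p), (A.pullback (2 * p)).hom (z i)
    rw [← map_sum, hz]
  rw [hxsum]
  refine Submodule.sum_mem _ fun i hi ↦ ?_
  exact Submodule.mem_iSup_of_mem i.1 (Submodule.mem_iSup_of_mem i.2
    (Submodule.mem_iSup_of_mem (mem_antidiagonal.1 hi)
      ⟨Submodule.mem_map_of_mem (hzP i hi), hzt i hi⟩))

/-! ### (ii) The orthogonal contains the `(2p, 0)`-classes -/

/-- **(ii) `V⊥` contains every class of type `(2p, 0)`.** For `X` smooth projective of dimension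
`2p` with Hodge model `A`, RATIONAL classes `b j ∈ H²ᵖ(X(ℂ); ℂ)` whose pulled-back span `W` is a
sub-Hodge structure with `W ⊓ H^{2p,0} = ⊥`, an orientation family `μ`, and `x` with
`A^* x ∈ H^{2p,0}`: `⟨b j ⌣ x, [X(ℂ)]⟩ = 0` for all `j`. Proof: `⟨b j ⌣ x⟩ = Σ ⟨w^{s,t} ⌣ x⟩` over the
Hodge components `w^{s,t} ∈ span b` of `b j` (`perpSubHodge_component_mem`); the terms with
`(s, t) ≠ (0, 2p)` vanish by types (`perpSubHodge_cupPairing_eq_zero_of_hodgeType`), and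
`A^* w^{0,2p} ∈ W ⊓ H^{0,2p} = ⊥` by reality of `W` and Hodge symmetry
(`perpSubHodge_inf_hodgePQ_swap_eq_bot`), so `w^{0,2p} = 0`.
[cite: VoisinHodgeI2002, §6.1.3 Cor. 6.12 and Lemma 7.30] -/
theorem perpSubHodge_containsTop (μ : OrientationFamily) {p : ℕ} (hX : IsSmoothProjective (2 * p) X)
    (A : HodgeModel (2 * p) X) {r : ℕ} {b : Fin r → complexBetti X (2 * p)}
    (hb : ∀ j, IsRationalClass (b j))
    (hsub : (Submodule.span ℂ (Set.range b)).map (A.pullback (2 * p)).hom =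
      ⨆ (p' : ℕ) (q' : ℕ) (_ : p' + q' = 2 * p),
        (Submodule.span ℂ (Set.range b)).map (A.pullback (2 * p)).hom ⊓ A.hodgePQ (2 * p) p' q')
    (hbot : (Submodule.span ℂ (Set.range b)).map (A.pullback (2 * p)).hom ⊓
      A.hodgePQ (2 * p) (2 * p) 0 = ⊥)
    (x : complexBetti X (2 * p)) (hx : A.pullback (2 * p) x ∈ A.hodgePQ (2 * p) (2 * p) 0) :
    x ∈ ⨅ j, LinearMap.ker (cupPairing (μ hX) (two_mul (2 * p)).symm (b j)) := by
  -- no `(0, 2p)`-part either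
  have h02 : (Submodule.span ℂ (Set.range b)).map (A.pullback (2 * p)).hom ⊓
      A.hodgePQ (2 * p) 0 (2 * p) = ⊥ :=
    perpSubHodge_inf_hodgePQ_swap_eq_bot hX A hb hbot
  rw [Submodule.mem_iInf]
  intro j
  rw [LinearMap.mem_ker]
  -- the Hodge components of `b j` lie in `span b`
  obtain ⟨w, hw, hwt⟩ := A.exists_sum_eq_of_hodgeDecomposition (2 * p) (b j)
  have hwV : ∀ i ∈ antidiagonal (2 * p), w i ∈ Submodule.span ℂ (Set.range b) :=
    perpSubHodge_component_mem A hsub (Submodule.subset_span ⟨j, rfl⟩) hw hwt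
  rw [← hw, LinearMap.map_sum₂]
  refine Finset.sum_eq_zero fun i hi ↦ ?_
  by_cases hi0 : i = (0, 2 * p)
  · -- the `(0, 2p)`-component of `b j` vanishes
    have htyp : A.pullback (2 * p) (w i) ∈ A.hodgePQ (2 * p) 0 (2 * p) := by
      have h' := hwt i hi
      rw [hi0] at h' ⊢
      simpa only using h'
    have hWi : A.pullback (2 * p) (w i) ∈
        (Submodule.span ℂ (Set.range b)).map (A.pullback (2 * p)).hom ⊓ A.hodgePQ (2 * p) 0 (2 * p) :=
      Submodule.mem_inf.2 ⟨Submodule.mem_map_of_mem (hwV i hi), htyp⟩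
    rw [h02, Submodule.mem_bot] at hWi
    have hw0 : w i = 0 := A.pullback_injective (2 * p) (by rw [hWi, map_zero])
    rw [hw0, LinearMap.map_zero₂]
  · refine perpSubHodge_cupPairing_eq_zero_of_hodgeType μ hX A _ ?_ (hwt i hi) hx
    rintro ⟨h1, h2⟩
    exact hi0 (Prod.ext (by omega) (by omega))

/-! ### The stub -/

/-- **STUB `stub_perpSubHodge` (Hodge theory of the orthogonal) of the crux `TranscendentalOrSupported`,
line `Sketch`.** For `p ≥ 1`, `X` smooth projective of dimension `2p`, a Hodge model `A`, rational
`b j ∈ H²ᵖ(X(ℂ); ℂ)` whose pulled-back span `W` satisfies `W = ⨆_{p'+q'=2p} W ⊓ H^{p',q'}` and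
`W ⊓ H^{2p,0} = ⊥`, and an orientation family `μ`: the right-orthogonal
`V⊥ = ⨅ⱼ ker ⟨b j ⌣ –, [X(ℂ)]⟩` (i) is a sub-Hodge structure read in `A` (`perpSubHodge_isSubHodge`:
type-orthogonality of the cup product pairing, Voisin I Lemma 7.30) and (ii) contains every class of
type `(2p, 0)` (`perpSubHodge_containsTop`: moreover `W ⊓ H^{0,2p} = ⊥` by reality of `W` and Hodge
symmetry, Voisin I Cor. 6.12). The hypothesis `1 ≤ p` is not needed.
[cite: VoisinHodgeI2002, §7.3.1, Lemma 7.30 and §6.1.3 Cor. 6.12] -/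
theorem stub_perpSubHodge :
    ∀ (μ : OrientationFamily) ⦃p : ℕ⦄ ⦃X : SchemeOver ℂ⦄, 1 ≤ p → ∀ (hX : IsSmoothProjective (2 * p) X)
    (A : HodgeModel (2 * p) X) (r : ℕ) (b : Fin r → complexBetti X (2 * p)),
    (∀ j, IsRationalClass (b j)) →
    (Submodule.span ℂ (Set.range b)).map (A.pullback (2 * p)).hom =
      ⨆ (p' : ℕ) (q' : ℕ) (_ : p' + q' = 2 * p),
        (Submodule.span ℂ (Set.range b)).map (A.pullback (2 * p)).hom ⊓ A.hodgePQ (2 * p) p' q' →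
    (Submodule.span ℂ (Set.range b)).map (A.pullback (2 * p)).hom ⊓ A.hodgePQ (2 * p) (2 * p) 0 = ⊥ →
    (⨅ j, LinearMap.ker (cupPairing (μ hX) (two_mul (2 * p)).symm (b j))).map (A.pullback (2 * p)).hom =
        ⨆ (p' : ℕ) (q' : ℕ) (_ : p' + q' = 2 * p),
          (⨅ j, LinearMap.ker (cupPairing (μ hX) (two_mul (2 * p)).symm (b j))).map
            (A.pullback (2 * p)).hom ⊓ A.hodgePQ (2 * p) p' q' ∧
      ∀ x : complexBetti X (2 * p), A.pullback (2 * p) x ∈ A.hodgePQ (2 * p) (2 * p) 0 →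
        x ∈ ⨅ j, LinearMap.ker (cupPairing (μ hX) (two_mul (2 * p)).symm (b j)) := by
  intro μ p X _ hX A r b hb hsub hbot
  exact ⟨perpSubHodge_isSubHodge μ hX A b hsub, perpSubHodge_containsTop μ hX A hb hsub hbot⟩

end Summit.HodgeConjecture.HodgeConjecture.Theorems

end
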